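import Summits.KontsevichZagierPeriods.KontsevichZagierPeriods.Theorems.OctahedralSymmetryOctahedralSpanAllWeightsStubRegularE0DepthOne
import HarnessLib

/-!
# Block F1 of the crux `OctahedralSpanAllWeights` (stmt-KontsevichZagierPeriods-9659), line `Sketch`: front reduction and the depth-two core

Helper file 2/3 for the stub `stub_regular_e0` (block F1), namespace `…OctaSpan.RegularE0`.
1. **Front reduction, all weights** (registered helper stub `frontReduce`): block F1 reduces to the
   words that BEGIN with the letter `4` (pole `0`), given F1 for shorter words. For `W = u 4 R` with
   maximal `4`-free prefix `u ≠ []`, the lift `u ш [4 R]` of the shorter word `4 R` lies in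
   `rel ⊔ e0Lower W` (lift principle), contains `W` once, and otherwise only interleavings with a strictly
   shorter `4`-free prefix (`pref_lt_of_mem_shuffleWord`): induction on the prefix length. (Word form of
   the free-module structure of `ℚ⟨{1,2,3,4}⟩` over the shuffle algebra of the unit letters.)
2. Family (U) of the depth-two block (`relU`): the lift `c ш (depth-one relation of 4^m d)` gives
   `∑_{j ≤ m} [4^j c 4^{m-j} d] + [4^m d c] ∈ rel ⊔ (lower span)`.
3. The algebraic core of the depth-two block (`depthTwo_core`): in any `ℚ`-module, unknowns `y a c d`
   (`a ≤ m`, `c, d ∈ {e₁,e₂,e₃}`) subject to the twelve merge relations per level (family (M)) and the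
   nine lift relations (family (U)) vanish, uniformly in `m ≥ 1` (`m = 1`: direct elimination; `m ≥ 2`:
   modulo (M) the `d = e₁, e₃` families are `(-1)^a g`, the `d = e₂` family is 2-periodic, and (U) kills
   the `≤ 4` parameters by parity; the line's lab confirms rank `9(m+1)` of (M)+(U) for `m ≤ 10`).

References: C. Reutenauer, Free Lie Algebras (1993), §1.4; J. Zhao, Doc. Math. 15 (2010), §2 [Zhao2010].
-/

noncomputable section

namespace Summit.KontsevichZagierPeriods.OctahedralSymmetry.OctaSpan.RegularE0

open Literature.NumberTheory.Transcendental Literature.NumberTheory.Transcendental.LevelFour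

/-- `u ++ 4 :: R` is one of the interleavings of `u` and `4 :: R`. [folklore] -/
theorem append_cons_mem_shuffleWord (u R : List (Fin 5)) :
    u ++ 4 :: R ∈ MZV.shuffleWord u (4 :: R) := by
  induction u with
  | nil => simp
  | cons a u ih =>
    rw [MZV.shuffleWord_cons_cons, List.mem_append, List.mem_map]
    exact Or.inl ⟨_, ih, rfl⟩

/-- Every OTHER interleaving of a `4`-free word `u` with `4 :: R` has its first `4` strictly before
position `|u|`. [folklore] -/
theorem pref_lt_of_mem_shuffleWord : ∀ (u R : List (Fin 5)), (4 : Fin 5) ∉ u →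
    ∀ w ∈ MZV.shuffleWord u (4 :: R), w ≠ u ++ 4 :: R → pref w < u.length
  | [], R, _, w, hw, hne => by simp at hw; exact (hne (by simpa using hw)).elim
  | a :: u, R, hu, w, hw, hne => by
    have ha : a ≠ 4 := fun h => hu (by simp [h])
    have hu' : (4 : Fin 5) ∉ u := fun h => hu (List.mem_cons_of_mem a h)
    rw [MZV.shuffleWord_cons_cons, List.mem_append, List.mem_map, List.mem_map] at hw
    rcases hw with ⟨w', hw', rfl⟩ | ⟨w', -, rfl⟩
    · have hne' : w' ≠ u ++ 4 :: R := fun h => hne (by rw [h]; rfl)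
      have := pref_lt_of_mem_shuffleWord u R hu' w' hw' hne'
      simp only [pref, List.length_cons] at this ⊢
      rw [List.takeWhile_cons_of_pos (by simpa using ha), List.length_cons]
      omega
    · simp [pref]

/-- **Front reduction (all weights).** Fix a length `n`. If block F1 holds for all shorter words, and for
the words of length `n` that BEGIN with the letter `4`, then it holds for every word of length `n`:
write `W = u 4 R` with `u` the maximal `4`-free prefix; `u ш [4 R] ∈ rel ⊔ e0Lower W` by the lift
principle and the hypothesis on the shorter word `4 R`, and all interleavings other than `W` have a
shorter `4`-free prefix (induction on the prefix length). [folklore] -/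
theorem frontReduce {n : ℕ}
    (ihlt : ∀ W : List (Fin 5), W.length < n → IsConvergent W → W.count 0 = 0 → 0 < W.count 4 →
      sym W ∈ rel ⊔ e0Lower W)
    (ih4 : ∀ W : List (Fin 5), W.length = n → W.head? = some 4 → IsConvergent W → W.count 0 = 0 →
      sym W ∈ rel ⊔ e0Lower W)
    (W : List (Fin 5)) (hn : W.length = n) (hW : IsConvergent W) (h0 : W.count 0 = 0)
    (h4 : 0 < W.count 4) : sym W ∈ rel ⊔ e0Lower W := by
  suffices key : ∀ p (W : List (Fin 5)), pref W = p → W.length = n → IsConvergent W →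
      W.count 0 = 0 → 0 < W.count 4 → sym W ∈ rel ⊔ e0Lower W from key _ W rfl hn hW h0 h4
  intro p
  induction p using Nat.strong_induction_on with
  | _ p ihp =>
  intro W hp hn hW h0 h4
  -- split `W = u ++ 4 :: R` at the first letter `4`
  set u := W.takeWhile fun x => x ≠ 4 with hu_def
  have hsplit : W = u ++ W.dropWhile fun x => x ≠ 4 := (List.takeWhile_append_dropWhile).symm
  have hD : (W.dropWhile fun x => x ≠ 4) ≠ [] := by
    rw [Ne, List.dropWhile_eq_nil_iff]
    intro h
    have h4mem : (4 : Fin 5) ∈ W := List.count_pos_iff.1 h4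
    simpa using h _ h4mem
  obtain ⟨R, hR⟩ : ∃ R, (W.dropWhile fun x => x ≠ 4) = 4 :: R := by
    refine ⟨(W.dropWhile fun x => x ≠ 4).tail, ?_⟩
    have hhead := List.head_dropWhile_not (fun x : Fin 5 => decide (x ≠ 4)) hD
    have hcons := List.cons_head_tail hD
    rw [← hcons]
    congr 1
    simpa using hhead
  rw [hR] at hsplit
  -- letters of `u`
  have hu4 : (4 : Fin 5) ∉ u := fun h => by simpa using List.mem_takeWhile_imp h
  have hu4c : u.count 4 = 0 := List.count_eq_zero.2 hu4
  have hcount0 : u.count 0 = 0 ∧ (4 :: R).count 0 = 0 := by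
    have := h0; rw [hsplit, List.count_append] at this; omega
  have hcount4 : W.count 4 = (4 :: R).count 4 := by
    conv_lhs => rw [hsplit, List.count_append, hu4c, zero_add]
  by_cases hu : u = []
  · -- `W` begins with `4`
    refine ih4 W hn ?_ hW h0
    rw [hsplit, hu]; rfl
  -- the shorter word `4 :: R`
  have hWlast : W.getLast? = (4 :: R).getLast? := by
    rw [hsplit, List.getLast?_append_of_ne_nil _ (List.cons_ne_nil _ _)]
  have hRconv : IsConvergent (4 :: R) := ⟨by simp, fun h => hW.2 (hWlast ▸ h)⟩
  have hulen : 0 < u.length := List.length_pos_iff.2 hu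
  have hRlen : (4 :: R).length < n := by
    have := congrArg List.length hsplit
    rw [List.length_append] at this; omega
  have hV : sym (4 :: R) ∈ rel ⊔ e0Lower (4 :: R) :=
    ihlt _ hRlen hRconv hcount0.2 (by simp)
  -- `u` is a convergent unit word
  have huconv : IsConvergent u := by
    constructor
    · intro h
      have : (0 : Fin 5) ∈ u := List.mem_of_mem_head? h
      exact (List.count_pos_iff.2 this).ne' hcount0.1
    · intro h
      exact hu4 (List.mem_of_mem_getLast? h)
  have hlift := liftMap_mem_sup_e0Lower huconv hcount0.1 hu4c hV
  rw [liftMap_sym_eq_sum, ← hsplit] at hlift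
  -- every other interleaving has a shorter `4`-free prefix, hence is already reduced
  refine sym_mem_of_sum_mem _ _ W (hsplit ▸ append_cons_mem_shuffleWord u R) hlift fun w hw hne => ?_
  have hp' : pref w < p := by
    rw [← hp]
    exact pref_lt_of_mem_shuffleWord u R hu4 w hw (hsplit ▸ hne)
  have hperm := MZV.perm_of_mem_shuffleWord _ _ hw
  have hwlen : w.length = n := by rw [hperm.length_eq, ← hsplit, hn]
  have hw0 : w.count 0 = 0 := by rw [hperm.count_eq, ← hsplit, h0]
  have hw4 : w.count 4 = W.count 4 := by rw [hperm.count_eq, ← hsplit]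
  have hwconv : IsConvergent w := isConvergent_of_mem_shuffleWord huconv hRconv hw
  have := ihp _ hp' w rfl hwlen hwconv hw0 (hw4 ▸ h4)
  rwa [e0Lower, hwlen, hw4, ← hn] at this

/-- **Family (U) of the depth-two block.** For unit letters `c, d` and `m ≥ 1`, the lift of the
depth-one reduction of `4^m d` by the letter `c` gives
`∑_{j ≤ m} [4^j c 4^{m-j} d] + [4^m d c] ∈ rel ⊔ (words with < m letters 4)`. [folklore] -/
theorem relU (m : ℕ) (hm : 1 ≤ m) (c d : Fin 5) (hc : c = 1 ∨ c = 2 ∨ c = 3)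
    (hd : d = 1 ∨ d = 2 ∨ d = 3) :
    (∑ j ∈ Finset.range (m + 1), sym (List.replicate j 4 ++ c :: (List.replicate (m - j) 4 ++ [d]))) +
        sym (List.replicate m 4 ++ [d, c]) ∈ rel ⊔ e0Lower (List.replicate m 4 ++ [d, c]) := by
  have hV := depthOne m hm d hd
  have hcconv : IsConvergent [c] := by rcases hc with rfl | rfl | rfl <;> decide
  have hc0 : [c].count 0 = 0 := by rcases hc with rfl | rfl | rfl <;> decide
  have hc4 : [c].count 4 = 0 := by rcases hc with rfl | rfl | rfl <;> decide
  have hc4' : c ≠ 4 := by rcases hc with rfl | rfl | rfl <;> decide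
  have hd4 : d ≠ 4 := by rcases hd with rfl | rfl | rfl <;> decide
  have h := liftMap_mem_sup_e0Lower hcconv hc0 hc4 hV
  rw [liftMap_sym_eq_sum, shuffleWord_singleton, List.map_map, List.length_append,
    List.length_replicate, List.length_singleton] at h
  have hsum : ((List.range (m + 1 + 1)).map (sym ∘ fun j =>
      List.take j (List.replicate m 4 ++ [d]) ++ c :: List.drop j (List.replicate m 4 ++ [d]))).sum =
      (∑ j ∈ Finset.range (m + 1), sym (List.replicate j 4 ++ c :: (List.replicate (m - j) 4 ++ [d]))) +
        sym (List.replicate m 4 ++ [d, c]) := by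
    rw [list_sum_range_map, Finset.sum_range_succ]
    congr 1
    · refine Finset.sum_congr rfl fun j hj => ?_
      have hj : j ≤ m := Nat.lt_succ_iff.1 (Finset.mem_range.1 hj)
      simp only [Function.comp_apply]
      rw [List.take_append_of_le_length (by simpa using hj), List.take_replicate, min_eq_left hj,
        List.drop_append_of_le_length (by simpa using hj), List.drop_replicate]
    · simp only [Function.comp_apply]
      rw [List.take_of_length_le (by simp), List.drop_of_length_le (by simp)]
      simp
  rw [hsum] at h
  have hL : e0Lower ([c] ++ (List.replicate m 4 ++ [d])) = e0Lower (List.replicate m 4 ++ [d, c]) :=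
    e0Lower_eq (by simp) (by simp [hc4', hd4])
  rwa [hL] at h

/-! ## The algebraic core of the depth-two block -/

/-- `∑_{j ≤ m} (-1)^j = (1 + (-1)^m)/2`. [folklore] -/
theorem alt_sum (m : ℕ) : ∑ j ∈ Finset.range (m + 1), (-1 : ℚ) ^ j = (1 + (-1) ^ m) / 2 := by
  induction m with
  | zero => norm_num
  | succ m ih => rw [Finset.sum_range_succ, ih, pow_succ]; ring

/-- **Algebraic core of the depth-two block.** In a `ℚ`-module, unknowns `y a c d` (`a ≤ m`, letters
`c, d ∈ {e₁, e₂, e₃}` = poles `i, -1, -i`) subject to the twelve "merge" relations per level (family (M):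
`y (a+1) c d = - y a (c/β) d` for the admissible `β`) and the nine "lift" relations (family (U):
`∑_{j ≤ m} y j c d + y m d c = 0`) all vanish, for every `m ≥ 1`: for `m = 1` a direct elimination; for
`m ≥ 2`, modulo (M) the `d = e₁` and `d = e₃` families are `(-1)^a g`, the `d = e₂` family is 2-periodic
in `a`, and (U) kills the `≤ 4` remaining parameters (a parity computation). [folklore] -/
theorem depthTwo_core {Q : Type*} [AddCommGroup Q] [Module ℚ Q] {ι : Type*} (e₁ e₂ e₃ : ι)
    (m : ℕ) (hm : 1 ≤ m) (y : ℕ → ι → ι → Q)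
    (M11a : ∀ a, a < m → y (a+1) e₁ e₁ = - y a e₃ e₁) (M11b : ∀ a, a < m → y (a+1) e₁ e₁ = - y a e₂ e₁)
    (M21 : ∀ a, a < m → y (a+1) e₂ e₁ = - y a e₃ e₁) (M31 : ∀ a, a < m → y (a+1) e₃ e₁ = - y a e₁ e₁)
    (M22a : ∀ a, a < m → y (a+1) e₂ e₂ = - y a e₁ e₂) (M22b : ∀ a, a < m → y (a+1) e₂ e₂ = - y a e₃ e₂)
    (M12 : ∀ a, a < m → y (a+1) e₁ e₂ = - y a e₂ e₂) (M32 : ∀ a, a < m → y (a+1) e₃ e₂ = - y a e₂ e₂)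
    (M33a : ∀ a, a < m → y (a+1) e₃ e₃ = - y a e₂ e₃) (M33b : ∀ a, a < m → y (a+1) e₃ e₃ = - y a e₁ e₃)
    (M13 : ∀ a, a < m → y (a+1) e₁ e₃ = - y a e₃ e₃) (M23 : ∀ a, a < m → y (a+1) e₂ e₃ = - y a e₁ e₃)
    (U : ∀ c d, c ∈ [e₁, e₂, e₃] → d ∈ [e₁, e₂, e₃] → ∑ j ∈ Finset.range (m + 1), y j c d + y m d c = 0) :
    ∀ a, a ≤ m → ∀ c d, c ∈ [e₁, e₂, e₃] → d ∈ [e₁, e₂, e₃] → y a c d = 0 := by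
  rcases Nat.lt_or_ge 1 m with hm2 | hm1
  swap
  · -- the case `m = 1` (weight 3): a direct elimination
    have hm : m = 1 := le_antisymm hm1 hm
    subst hm
    have U' : ∀ c d, c ∈ [e₁, e₂, e₃] → d ∈ [e₁, e₂, e₃] → y 0 c d + y 1 c d + y 1 d c = 0 := by
      intro c d hc hd
      have h := U c d hc hd
      rwa [Finset.sum_range_succ, Finset.sum_range_succ, Finset.sum_range_zero, zero_add] at h
    have A1 := M11a 0 one_pos; have A2 := M11b 0 one_pos; have A3 := M21 0 one_pos
    have A4 := M31 0 one_pos; have B1 := M22a 0 one_pos; have B2 := M22b 0 one_pos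
    have B3 := M12 0 one_pos; have B4 := M32 0 one_pos; have C1 := M33a 0 one_pos
    have C2 := M33b 0 one_pos; have C3 := M13 0 one_pos; have C4 := M23 0 one_pos
    simp only [zero_add] at A1 A2 A3 A4 B1 B2 B3 B4 C1 C2 C3 C4
    have hp : y 0 e₃ e₁ = y 0 e₂ e₁ := neg_inj.1 (A1.symm.trans A2)
    have hq : y 0 e₁ e₂ = y 0 e₃ e₂ := neg_inj.1 (B1.symm.trans B2)
    have hr : y 0 e₂ e₃ = y 0 e₁ e₃ := neg_inj.1 (C1.symm.trans C2)
    have two : ∀ x : Q, -x + -x = 0 → x = 0 := fun x hx => by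
      have h2 : (2 : ℚ) • x = 0 := by rw [two_smul, ← neg_add, neg_eq_zero] at *; exact hx
      exact (smul_eq_zero.1 h2).resolve_left two_ne_zero
    -- t = y0(e₂,e₂) = 0 from U(e₂,e₁)
    have t0 : y 0 e₂ e₂ = 0 := by
      have h := U' e₂ e₁ (by simp) (by simp)
      rw [A3, B3, hp, add_neg_cancel, zero_add, neg_eq_zero] at h
      exact h
    -- q = y0(e₁,e₂) = 0 from U(e₂,e₂)
    have q0 : y 0 e₁ e₂ = 0 := by
      have h := U' e₂ e₂ (by simp) (by simp)
      rw [B1, t0, zero_add] at h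
      exact two _ h
    have q0' : y 0 e₃ e₂ = 0 := hq ▸ q0
    -- p = y0(e₃,e₁) = 0 from U(e₁,e₂)
    have p0 : y 0 e₃ e₁ = 0 := by
      have h := U' e₁ e₂ (by simp) (by simp)
      rw [B3, A3, q0, t0, neg_zero, zero_add, zero_add, neg_eq_zero] at h
      exact h
    have p0' : y 0 e₂ e₁ = 0 := hp ▸ p0
    -- s = y0(e₁,e₁) = 0 from U(e₁,e₁)
    have s0 : y 0 e₁ e₁ = 0 := by
      have h := U' e₁ e₁ (by simp) (by simp)
      rw [A1, p0, neg_zero, add_zero, add_zero] at h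
      exact h
    -- u = y0(e₃,e₃) = 0 from U(e₃,e₁)
    have u0 : y 0 e₃ e₃ = 0 := by
      have h := U' e₃ e₁ (by simp) (by simp)
      rw [A4, C3, p0, s0, neg_zero, zero_add, zero_add, neg_eq_zero] at h
      exact h
    -- r = y0(e₂,e₃) = 0 from U(e₃,e₃)
    have r0 : y 0 e₂ e₃ = 0 := by
      have h := U' e₃ e₃ (by simp) (by simp)
      rw [C1, u0, zero_add] at h
      exact two _ h
    have r0' : y 0 e₁ e₃ = 0 := hr ▸ r0
    intro a ha c d hc hd
    simp only [List.mem_cons, List.not_mem_nil, or_false] at hc hd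
    rcases Nat.le_one_iff_eq_zero_or_eq_one.1 ha with rfl | rfl
    · rcases hc with rfl | rfl | rfl <;> rcases hd with rfl | rfl | rfl <;> assumption
    · rcases hc with rfl | rfl | rfl <;> rcases hd with rfl | rfl | rfl <;>
        simp [A2, A3, A4, B1, B3, B4, C2, C3, C4, s0, p0, p0', q0, r0', u0, t0]
  have hm : 2 ≤ m := hm2
  have hne : ∑ j ∈ Finset.range (m + 1), (-1 : ℚ) ^ j + (-1) ^ m ≠ 0 := by
    rw [alt_sum]
    rcases neg_one_pow_eq_or ℚ m with h | h <;> rw [h] <;> norm_num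
  -- family d = 1
  have L1 : ∀ a, a < m → y a e₃ e₁ = y a e₂ e₁ := fun a ha => by
    have h1 := M11a a ha; rw [M11b a ha] at h1; exact (neg_inj.1 h1).symm
  set g := y 0 e₁ e₁ with hg
  have S1 : ∀ a, a ≤ m → y a e₁ e₁ = (-1 : ℚ) ^ a • g ∧ y a e₂ e₁ = (-1 : ℚ) ^ a • g ∧
      y a e₃ e₁ = (-1 : ℚ) ^ a • g := by
    intro a
    induction a with
    | zero =>
      intro _
      have h31 : y 0 e₃ e₁ = g := by
        have h := M31 0 (by omega); rw [L1 1 (by omega), M21 0 (by omega)] at h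
        exact (neg_inj.1 h)
      refine ⟨by simp [hg], ?_, by simpa using h31⟩
      rw [← L1 0 (by omega), h31]; simp
    | succ a ih =>
      intro ha
      obtain ⟨h1, h2, h3⟩ := ih (by omega)
      refine ⟨?_, ?_, ?_⟩
      · rw [M11b a (by omega), h2, pow_succ]; module
      · rw [M21 a (by omega), h3, pow_succ]; module
      · rw [M31 a (by omega), h1, pow_succ]; module
  have g0 : g = 0 := by
    have h := U e₁ e₁ (by simp) (by simp)
    rw [Finset.sum_congr rfl fun j hj => (S1 j (by have := Finset.mem_range.1 hj; omega)).1,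
      (S1 m le_rfl).1, ← Finset.sum_smul, ← add_smul] at h
    exact (smul_eq_zero.1 h).resolve_left hne
  -- family d = 3
  have L3 : ∀ a, a < m → y a e₂ e₃ = y a e₁ e₃ := fun a ha => by
    have h1 := M33a a ha; rw [M33b a ha] at h1; exact (neg_inj.1 h1).symm
  set g' := y 0 e₃ e₃ with hg'
  have S3 : ∀ a, a ≤ m → y a e₃ e₃ = (-1 : ℚ) ^ a • g' ∧ y a e₁ e₃ = (-1 : ℚ) ^ a • g' ∧
      y a e₂ e₃ = (-1 : ℚ) ^ a • g' := by
    intro a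
    induction a with
    | zero =>
      intro _
      have h13 : y 0 e₁ e₃ = g' := by
        have h := M13 0 (by omega); rw [← L3 1 (by omega), M23 0 (by omega)] at h
        exact (neg_inj.1 h)
      refine ⟨by simp [hg'], by simpa using h13, ?_⟩
      rw [L3 0 (by omega), h13]; simp
    | succ a ih =>
      intro ha
      obtain ⟨h1, h2, h3⟩ := ih (by omega)
      refine ⟨?_, ?_, ?_⟩
      · rw [M33b a (by omega), h2, pow_succ]; module
      · rw [M13 a (by omega), h1, pow_succ]; module
      · rw [M23 a (by omega), h2, pow_succ]; module
  have g0' : g' = 0 := by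
    have h := U e₃ e₃ (by simp) (by simp)
    rw [Finset.sum_congr rfl fun j hj => (S3 j (by have := Finset.mem_range.1 hj; omega)).1,
      (S3 m le_rfl).1, ← Finset.sum_smul, ← add_smul] at h
    exact (smul_eq_zero.1 h).resolve_left hne
  -- family d = 2
  have L2 : ∀ a, a < m → y a e₁ e₂ = y a e₃ e₂ := fun a ha => by
    have h1 := M22a a ha; rw [M22b a ha] at h1; exact (neg_inj.1 h1).symm
  set δ := y 0 e₂ e₂ with hδ
  set ο := y 0 e₁ e₂ with hο
  have S2 : ∀ a, a ≤ m → (Even a → y a e₂ e₂ = δ ∧ y a e₁ e₂ = ο ∧ y a e₃ e₂ = ο) ∧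
      (Odd a → y a e₂ e₂ = -ο ∧ y a e₁ e₂ = -δ ∧ y a e₃ e₂ = -δ) := by
    intro a
    induction a with
    | zero =>
      intro _
      refine ⟨fun _ => ⟨rfl, rfl, (L2 0 (by omega)).symm⟩, fun h => ?_⟩
      exact absurd h (by decide)
    | succ a ih =>
      intro ha
      obtain ⟨he, ho⟩ := ih (by omega)
      refine ⟨fun h => ?_, fun h => ?_⟩
      · have hao : Odd a := Nat.not_even_iff_odd.1 (Nat.even_add_one.1 h)
        obtain ⟨h1, h2, h3⟩ := ho hao
        refine ⟨?_, ?_, ?_⟩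
        · rw [M22a a (by omega), h2, neg_neg]
        · rw [M12 a (by omega), h1, neg_neg]
        · rw [M32 a (by omega), h1, neg_neg]
      · have hae : Even a := by
          by_contra hc
          exact (Nat.not_even_iff_odd.2 h) (Nat.even_add_one.2 hc)
        obtain ⟨h1, h2, h3⟩ := he hae
        refine ⟨?_, ?_, ?_⟩
        · rw [M22a a (by omega), h2]
        · rw [M12 a (by omega), h1]
        · rw [M32 a (by omega), h1]
  -- consequences of (U 2 1): the top off-diagonal value of the `d = 2` family vanishes
  have hοm : y m e₁ e₂ = 0 := by
    have h := U e₂ e₁ (by simp) (by simp)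
    rw [Finset.sum_congr rfl fun j hj => (S1 j (by have := Finset.mem_range.1 hj; omega)).2.1,
      ← Finset.sum_smul, g0,
      smul_zero, zero_add] at h
    exact h
  -- pair sums of the `d = 2` diagonal
  have pair : ∀ k, 2 * k ≤ m + 1 → ∑ j ∈ Finset.range (2 * k), y j e₂ e₂ = (k : ℚ) • (δ - ο) := by
    intro k
    induction k with
    | zero => intro; simp
    | succ k ih =>
      intro hk
      rw [show 2 * (k + 1) = 2 * k + 1 + 1 by ring, Finset.sum_range_succ, Finset.sum_range_succ,
        ih (by omega),
        ((S2 (2 * k) (by omega)).1 (even_two_mul k)).1,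
        ((S2 (2 * k + 1) (by omega)).2 (odd_two_mul_add_one k)).1]
      push_cast
      module
  have hzero : δ = 0 ∧ ο = 0 := by
    obtain ⟨k, rfl | rfl⟩ := Nat.even_or_odd' m
    · have hο0 : ο = 0 := by rw [← ((S2 (2 * k) le_rfl).1 (even_two_mul k)).2.1]; exact hοm
      refine ⟨?_, hο0⟩
      have h := U e₂ e₂ (by simp) (by simp)
      rw [Finset.sum_range_succ, pair k (by omega), ((S2 (2 * k) le_rfl).1 (even_two_mul k)).1, hο0,
        sub_zero] at h
      have h' : ((k : ℚ) + 2) • δ = 0 := by rw [← h]; module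
      exact (smul_eq_zero.1 h').resolve_left (by positivity)
    · have hδ0 : δ = 0 := by
        have h1 := ((S2 (2 * k + 1) le_rfl).2 (odd_two_mul_add_one k)).2.1
        rw [h1] at hοm
        exact neg_eq_zero.1 hοm
      refine ⟨hδ0, ?_⟩
      have h := U e₂ e₂ (by simp) (by simp)
      rw [show 2 * k + 1 + 1 = 2 * (k + 1) by ring, pair (k + 1) (by omega),
        ((S2 (2 * k + 1) le_rfl).2 (odd_two_mul_add_one k)).1, hδ0, zero_sub] at h
      have h' : ((k : ℚ) + 2) • ο = 0 := by rw [← neg_eq_zero, ← h]; push_cast; module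
      exact (smul_eq_zero.1 h').resolve_left (by positivity)
  obtain ⟨hδ0, hο0⟩ := hzero
  -- conclusion
  intro a ha c d hc hd
  simp only [List.mem_cons, List.not_mem_nil, or_false] at hc hd
  obtain ⟨s1, s2, s3⟩ := S1 a ha
  obtain ⟨t1, t2, t3⟩ := S3 a ha
  obtain ⟨e2, o2⟩ := S2 a ha
  rcases hd with rfl | rfl | rfl
  · rcases hc with rfl | rfl | rfl <;> simp [s1, s2, s3, g0]
  · rcases Nat.even_or_odd a with hpa | hpa
    · obtain ⟨u1, u2, u3⟩ := e2 hpa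
      rcases hc with rfl | rfl | rfl <;> simp [u1, u2, u3, hο0, hδ0]
    · obtain ⟨u1, u2, u3⟩ := o2 hpa
      rcases hc with rfl | rfl | rfl <;> simp [u1, u2, u3, hο0, hδ0]
  · rcases hc with rfl | rfl | rfl <;> simp [t1, t2, t3, g0']

end Summit.KontsevichZagierPeriods.OctahedralSymmetry.OctaSpan.RegularE0

end
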